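import Summits.Ventures.HodgeRepro2.T5SU11SphericalDecayFluxIdentity
import Summits.Ventures.HodgeRepro2.T5SU11KernelEnds

/-!
# The decaying solution is strictly convex for `λ ≥ 2`

From the radial equation `sinh 2t χ_λ″ = μ sinh 2t χ_λ − 2 cosh 2t χ_λ′` with `χ_λ > 0`, `χ_λ′ < 0` (row 636) and `μ = λ(λ − 2) ≥ 0`:

* `sphDecay''_pos` — **`χ_λ″(t) > 0`** for every `t > 0` and `λ ≥ 2`;
* `deriv_sphDecay_eventuallyEq`, `deriv2_sphDecay_eq` — `deriv χ_λ = χ_λ′` near every `t > 0` and `deriv² χ_λ(t) = χ_λ″(t)`;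
* `sphDecay_strictConvexOn` — **`χ_λ` is strictly convex on `(0, ∞)` for `λ ≥ 2`**;
* `kernel_strictConcaveOn_Ici` — hence **`t ↦ K_λ(t, s)` is strictly concave on `[s, ∞)`** for `λ ≥ 2` (`K_λ(t, s) = −φ_λ(a_s) χ_λ(t)` there).

Nothing is claimed about (N).

Blind lane: Mathlib + the HodgeRepro2 prefix only; no sorry; axioms ⊆ {propext, Classical.choice,
Quot.sound}.
-/

namespace Summit.Ventures.HodgeRepro2.T5SU11SphericalDecayConvex

open Filter Topology MeasureTheory
open Set (Ioi Ici)
open T5SU11Cartan T5SU11SphericalFunction T5SU11SphericalBounds T5SU11SphericalDecay T5SU11ReductionOfOrder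
  T5SU11RadialGreenKernel T5SU11KernelEnds T5SU11SphericalDecayFluxIdentity

section measure

variable [MeasurableSpace Circle] [BorelSpace Circle]

variable {lam : ℝ} (hlam : 1 < lam)

include hlam in
/-- **`χ_λ″(t) > 0`** for `t > 0` and `λ ≥ 2`. -/
theorem sphDecay''_pos (h2 : 2 ≤ lam) {t : ℝ} (ht : 0 < t) : 0 < sphDecay'' lam t := by
  have hode := sphDecay_ode hlam ht
  have hs : 0 < Real.sinh (2 * t) := sinh_two_mul_pos ht
  have hc : 0 < Real.cosh (2 * t) := Real.cosh_pos _
  have hχ : 0 < sphDecay lam t := sphDecay_pos hlam ht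
  have hχ' : sphDecay' lam t < 0 := sphDecay'_neg hlam ht
  have hμ : 0 ≤ lam * (lam - 2) := mul_nonneg (by linarith) (by linarith)
  have h1 : 0 < Real.sinh (2 * t) * sphDecay'' lam t := by
    have e : Real.sinh (2 * t) * sphDecay'' lam t
        = lam * (lam - 2) * Real.sinh (2 * t) * sphDecay lam t - 2 * Real.cosh (2 * t) * sphDecay' lam t := by
      linarith
    rw [e]
    have : 0 ≤ lam * (lam - 2) * Real.sinh (2 * t) * sphDecay lam t := by positivity
    nlinarith
  exact pos_of_mul_pos_right h1 hs.le

include hlam in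
/-- `deriv χ_λ = χ_λ′` near every `t > 0`. -/
theorem deriv_sphDecay_eventuallyEq {t : ℝ} (ht : 0 < t) : deriv (sphDecay lam) =ᶠ[𝓝 t] sphDecay' lam := by
  filter_upwards [Ioi_mem_nhds ht] with x hx
  exact (hasDerivAt_sphDecay hlam hx).deriv

include hlam in
/-- `deriv² χ_λ(t) = χ_λ″(t)` for `t > 0`. -/
theorem deriv2_sphDecay_eq {t : ℝ} (ht : 0 < t) : deriv^[2] (sphDecay lam) t = sphDecay'' lam t := by
  simp only [Function.iterate_succ, Function.iterate_zero, Function.comp, id]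
  rw [(deriv_sphDecay_eventuallyEq hlam ht).deriv_eq]
  exact (hasDerivAt_sphDecay' lam ht).deriv

include hlam in
/-- **`χ_λ` is strictly convex on `(0, ∞)` for `λ ≥ 2`.** -/
theorem sphDecay_strictConvexOn (h2 : 2 ≤ lam) : StrictConvexOn ℝ (Ioi 0) (sphDecay lam) := by
  refine strictConvexOn_of_deriv2_pos (convex_Ioi 0) ?_ ?_
  · intro x hx
    exact (hasDerivAt_sphDecay hlam hx).continuousAt.continuousWithinAt
  · intro x hx
    rw [interior_Ioi] at hx
    rw [deriv2_sphDecay_eq hlam hx]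
    exact sphDecay''_pos hlam h2 hx

include hlam in
/-- **`t ↦ K_λ(t, s)` is strictly concave on `[s, ∞)`** for `λ ≥ 2` and `s > 0`. -/
theorem kernel_strictConcaveOn_Ici (h2 : 2 ≤ lam) {s : ℝ} (hs : 0 < s) :
    StrictConcaveOn ℝ (Ici s) (fun t => sphGreenKernel lam t s) := by
  have hconv : StrictConvexOn ℝ (Ici s) (sphDecay lam) :=
    (sphDecay_strictConvexOn hlam h2).subset (fun t ht => lt_of_lt_of_le hs ht) (convex_Ici s)
  have hφ : 0 < sph lam (hyp s) := sph_hyp_pos lam s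
  refine ⟨convex_Ici s, fun x hx y hy hxy a b ha hb hab => ?_⟩
  have hmem : a • x + b • y ∈ Ici s := (convex_Ici s) hx hy ha.le hb.le hab
  have hlt := hconv.2 hx hy hxy ha hb hab
  simp only [smul_eq_mul] at hlt hmem ⊢
  rw [kernel_eq_of_ge lam hx, kernel_eq_of_ge lam hy, kernel_eq_of_ge lam hmem]
  nlinarith

end measure

end Summit.Ventures.HodgeRepro2.T5SU11SphericalDecayConvex
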